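import Literature.AlgebraicGeometry.Frobenioids.BiratUnitsAut
import Literature.AlgebraicGeometry.Frobenioids.BiratUnitsPullback
import HarnessLib

/-!
# Frobenioids I, Proposition 2.2 (ii)(a) for `C^birat`: transport of `O^×(A^birat)` along pull-back
morphisms (uniqueness, homomorphism)

Mochizuki, *The geometry of Frobenioids I: the general theory*, Kyushu J. Math. **62** (2008)
293–400, §1 Proposition 1.11 (iv) p. 36 ("natural injection `O^▷(A') ↪ O^▷(A)` … uniquely
determined by `β ∘ φ = φ ∘ α`"), §2 Proposition 2.2 (ii)(a) p. 45, §4 Proposition 4.4 (iv) p. 83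
[cite: MochizukiFrdI2008, Prop. 1.11(iv) p.36].

Over `BiratUnitsAut.lean` (the embedding `toHom : O^×(A^birat) → End_{C^birat}(A^birat)`) this file
(1) identifies the fraction-level relation `BiratUnits.Intertwines ψ u v` (v2) with the equation
"`ψ ∘ u = v ∘ ψ`" in the category `C^birat` (`intertwines_iff_toHom_comm`); (2) proves that along a
pull-back morphism `ψ` the intertwined `u` is UNIQUE (`eq_of_intertwines_of_isPullbackMorphism`: the
universal property of `ψ`, `IsPullbackMorphism.hom_ext`, seat abc-iut-L1-t1); (3) combined with the
existence of `BiratUnitsPullback.lean` (isotropic type) defines the pull-back homomorphism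
`BiratUnits.pullbackHom ψ : O^×(A'^birat) →* O^×(A^birat)` — Prop. 1.11 (iv) for `C^birat`, i.e. the
value of the rational function monoid on `Base ψ` (Prop. 2.2 (ii)(a)).  Hypotheses `hsq` (Prop. 1.11
(vii)) and `hiso` (isotropic type) as in the files used.
-/

namespace Literature.AlgebraicGeometry.Frobenioids

open CategoryTheory Opposite

universe w v v' u u'

namespace PreFrobenioid

namespace BiratUnits

variable {D : Type u} [Category.{v} D] {Φ : Dᵒᵖ ⥤ CommMonCat.{w}}
  {C : Type u'} [Category.{v'} C] {F : C ⥤ ElemFrobenioid Φ} {hF : IsFrobenioid F}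
  {hsq : HasBiratSquares F} {A A' : C}

/-! ### `Intertwines` is the equation `ψ ∘ u = v ∘ ψ` of `C^birat` -/

/-- For a fraction `p = (α, φ)` at `A` and `ψ : A → A'`: `ψ ∘ [(α, φ)] = [(α, φ ≫ ψ)]` in `C^birat`.
[cite: MochizukiFrdI2008, Prop. 4.4(i) p.84] -/
theorem toHom_mk_comp_toBirat_map (p : RatFrac F A) (ψ : A ⟶ A') :
    toHom hsq (mk hF p) ≫ (toBirat F hF hsq).map ψ =
      Birat.homMk (X := (toBirat F hF hsq).obj A) (Y := (toBirat F hF hsq).obj A')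
        ⟨p.src, p.den, p.num ≫ ψ, p.den_mem⟩ := by
  let S : BiratFrac.Square p.toBiratFrac (BiratFrac.ofHom hF ψ) :=
    { apex := p.src, left := 𝟙 _, right := p.num, left_mem := isCoAngularPreStep_id hF _
      w := by
        change 𝟙 _ ≫ p.num = p.num ≫ 𝟙 A
        rw [Category.id_comp, Category.comp_id] }
  refine (Birat.homMk_comp_homMk_eq (X := (toBirat F hF hsq).obj A) (Y := (toBirat F hF hsq).obj A)
    (Z := (toBirat F hF hsq).obj A') p.toBiratFrac (BiratFrac.ofHom hF ψ) S).trans ?_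
  apply Birat.homMk_sound
  refine ⟨p.src, 𝟙 _, 𝟙 _, isCoAngularPreStep_id hF _, isCoAngularPreStep_id hF _, ?_, ?_⟩
  · change 𝟙 _ ≫ 𝟙 _ ≫ p.den = 𝟙 _ ≫ p.den
    rw [Category.id_comp]
  · change 𝟙 _ ≫ p.num ≫ ψ = 𝟙 _ ≫ p.num ≫ ψ
    rfl

/-- For a fraction `q = (β, χ)` at `A'`, `ψ : A → A'` and a square `(κ', l)` (`κ'` a co-angular
pre-step
into `A`, `κ' ≫ ψ = l ≫ β`): `[(β, χ)] ∘ ψ = [(κ', l ≫ χ)]` in `C^birat`.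
[cite: MochizukiFrdI2008, Prop. 4.4(i) p.84] -/
theorem toBirat_map_comp_toHom_mk (q : RatFrac F A') (ψ : A ⟶ A') {E : C} (κ' : E ⟶ A)
    (hκ' : IsCoAngularPreStep F κ') (l : E ⟶ q.src) (hw : κ' ≫ ψ = l ≫ q.den) :
    (toBirat F hF hsq).map ψ ≫ toHom hsq (mk hF q) =
      Birat.homMk (X := (toBirat F hF hsq).obj A) (Y := (toBirat F hF hsq).obj A')
        ⟨E, κ', l ≫ q.num, hκ'⟩ := by
  let S : BiratFrac.Square (BiratFrac.ofHom hF ψ) q.toBiratFrac :=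
    { apex := E, left := κ', right := l, left_mem := hκ', w := hw }
  refine (Birat.homMk_comp_homMk_eq (X := (toBirat F hF hsq).obj A) (Y := (toBirat F hF hsq).obj A')
    (Z := (toBirat F hF hsq).obj A') (BiratFrac.ofHom hF ψ) q.toBiratFrac S).trans ?_
  apply Birat.homMk_sound
  refine ⟨E, 𝟙 E, 𝟙 E, isCoAngularPreStep_id hF E, isCoAngularPreStep_id hF E, ?_, rfl⟩
  change 𝟙 E ≫ κ' ≫ 𝟙 A = 𝟙 E ≫ κ'
  rw [Category.comp_id]

/-- **`Intertwines` = "`ψ ∘ u = v ∘ ψ` in `C^birat`"** (v2 relation; both directions).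
[cite: MochizukiFrdI2008, Prop. 4.4(iv) p.83] -/
theorem intertwines_iff_toHom_comm (hsq : HasBiratSquares F) (ψ : A ⟶ A') (u : BiratUnits F hF A)
    (v : BiratUnits F hF A') :
    Intertwines hF ψ u v ↔
      toHom hsq u ≫ (toBirat F hF hsq).map ψ = (toBirat F hF hsq).map ψ ≫ toHom hsq v := by
  constructor
  · rintro ⟨p, q, E, κ, l, rfl, rfl, hκ, h₁, h₂⟩
    have hw : (κ ≫ p.den) ≫ ψ = l ≫ q.den := by rw [h₁, Category.assoc]
    rw [toHom_mk_comp_toBirat_map, toBirat_map_comp_toHom_mk q ψ (κ ≫ p.den) (hκ.comp hF p.den_mem)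
      l hw]
    apply Birat.homMk_sound
    refine ⟨E, κ, 𝟙 E, hκ, isCoAngularPreStep_id hF E, ?_, ?_⟩
    · change κ ≫ p.den = 𝟙 E ≫ κ ≫ p.den
      rw [Category.id_comp]
    · change κ ≫ p.num ≫ ψ = 𝟙 E ≫ l ≫ q.num
      rw [Category.id_comp, h₂]
  · intro heq
    obtain ⟨p, rfl⟩ := mk_surjective u
    obtain ⟨q, rfl⟩ := mk_surjective v
    let S₀ := BiratFrac.someSquare hsq (BiratFrac.ofHom hF ψ) q.toBiratFrac
    have hw : S₀.left ≫ ψ = (S₀.right : S₀.apex ⟶ q.src) ≫ q.den := S₀.w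
    rw [toHom_mk_comp_toBirat_map, toBirat_map_comp_toHom_mk q ψ S₀.left S₀.left_mem S₀.right hw]
      at heq
    obtain ⟨E, ε, ε', hε, hε', hden, hnum⟩ := Birat.homMk_eq_homMk_iff.mp heq
    change ε ≫ p.den = ε' ≫ S₀.left at hden
    change ε ≫ p.num ≫ ψ = ε' ≫ (S₀.right : S₀.apex ⟶ q.src) ≫ q.num at hnum
    refine ⟨p, q, E, ε, ε' ≫ S₀.right, rfl, rfl, hε, ?_, ?_⟩
    · have e1 : (ε' ≫ S₀.right : E ⟶ q.src) ≫ q.den = ε' ≫ S₀.left ≫ ψ := by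
        rw [Category.assoc]
        exact congrArg (fun t => ε' ≫ t) hw.symm
      rw [e1, ← Category.assoc, ← hden]
      exact Category.assoc _ _ _
    · rw [Category.assoc]
      exact hnum.symm

/-! ### Uniqueness along pull-back morphisms (Prop. 1.11 (iv)) -/

/-- Cancellation: if `ψ` is a pull-back morphism and `ψ ∘ u = ψ ∘ u'` in `C^birat` for
`u, u' ∈ O^×(A^birat)`, then `u = u'` (the universal property of `ψ`: two morphisms to `A` with the
same
composite with `ψ` and the same base map coincide). [cite: MochizukiFrdI2008, Prop. 1.11(iv) p.36]
-/
theorem eq_of_toHom_comp_eq {ψ : A ⟶ A'} (hψ : IsPullbackMorphism F ψ) {u u' : BiratUnits F hF A}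
    (h : toHom hsq u ≫ (toBirat F hF hsq).map ψ = toHom hsq u' ≫ (toBirat F hF hsq).map ψ) :
    u = u' := by
  obtain ⟨p, rfl⟩ := mk_surjective u
  obtain ⟨p', rfl⟩ := mk_surjective u'
  rw [toHom_mk_comp_toBirat_map, toHom_mk_comp_toBirat_map] at h
  obtain ⟨E, ε, ε', hε, hε', hden, hnum⟩ := Birat.homMk_eq_homMk_iff.mp h
  change ε ≫ p.den = ε' ≫ p'.den at hden
  change ε ≫ p.num ≫ ψ = ε' ≫ p'.num ≫ ψ at hnum
  apply sound
  refine ⟨E, ε, ε', hε, hε', hden, ?_⟩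
  apply hψ.hom_ext
  · rw [Category.assoc, Category.assoc, hnum]
  · rw [base_comp, base_comp, ← p.baseEq, ← p'.baseEq, ← base_comp, ← base_comp, hden]

/-- **Prop. 1.11 (iv) for `C^birat`, uniqueness**: along a pull-back morphism `ψ : A → A'`, a
rational
function `v ∈ O^×(A'^birat)` is intertwined with AT MOST ONE `u ∈ O^×(A^birat)`.
[cite: MochizukiFrdI2008, Prop. 1.11(iv) p.36] -/
theorem eq_of_intertwines_of_isPullbackMorphism (hsq : HasBiratSquares F) {ψ : A ⟶ A'}
    (hψ : IsPullbackMorphism F ψ) {u u' : BiratUnits F hF A} {v : BiratUnits F hF A'}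
    (h : Intertwines hF ψ u v) (h' : Intertwines hF ψ u' v) : u = u' := by
  rw [intertwines_iff_toHom_comm hsq] at h h'
  exact eq_of_toHom_comp_eq hψ (h.trans h'.symm)

/-- Intertwining is multiplicative (composition of commuting squares in `C^birat`).
[cite: MochizukiFrdI2008, Prop. 1.11(iv) p.36] -/
theorem Intertwines.mul (hsq : HasBiratSquares F) {ψ : A ⟶ A'} {u₁ u₂ : BiratUnits F hF A}
    {v₁ v₂ : BiratUnits F hF A'} (h₁ : Intertwines hF ψ u₁ v₁) (h₂ : Intertwines hF ψ u₂ v₂) :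
    Intertwines hF ψ (u₁ * u₂) (v₁ * v₂) := by
  rw [intertwines_iff_toHom_comm hsq] at h₁ h₂ ⊢
  rw [toHom_mul, toHom_mul, Category.assoc, h₁, ← Category.assoc, h₂, Category.assoc]

/-- `1` is intertwined with `1`. [cite: MochizukiFrdI2008, Prop. 1.11(iv) p.36] -/
theorem Intertwines.one (hsq : HasBiratSquares F) (ψ : A ⟶ A') :
    Intertwines hF ψ (1 : BiratUnits F hF A) (1 : BiratUnits F hF A') := by
  rw [intertwines_iff_toHom_comm hsq, toHom_one, toHom_one, Category.id_comp, Category.comp_id]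

variable (hF) in
/-- **Prop. 1.11 (iv) / 2.2 (ii)(a) for `C^birat`**: the pull-back homomorphism
`O^×(A'^birat) → O^×(A^birat)` along a pull-back morphism `ψ : A → A'` of a Frobenioid of isotropic
type — `v ↦` the unique `u` with `ψ ∘ u = v ∘ ψ` (the value `B(Base ψ)` of the rational function
monoid). [cite: MochizukiFrdI2008, Prop. 2.2(ii) p.45] -/
noncomputable def pullbackHom (hsq : HasBiratSquares F) (hiso : IsOfIsotropicType F) (ψ : A ⟶ A')
    (hψ : IsPullbackMorphism F ψ) : BiratUnits F hF A' →* BiratUnits F hF A where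
  toFun v := (exists_intertwines_of_isPullbackMorphism hF hiso ψ hψ v).choose
  map_one' := eq_of_intertwines_of_isPullbackMorphism hsq hψ
    (exists_intertwines_of_isPullbackMorphism hF hiso ψ hψ 1).choose_spec (Intertwines.one hsq ψ)
  map_mul' v₁ v₂ := eq_of_intertwines_of_isPullbackMorphism hsq hψ
    (exists_intertwines_of_isPullbackMorphism hF hiso ψ hψ (v₁ * v₂)).choose_spec
    (Intertwines.mul hsq (exists_intertwines_of_isPullbackMorphism hF hiso ψ hψ v₁).choose_spec
      (exists_intertwines_of_isPullbackMorphism hF hiso ψ hψ v₂).choose_spec)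

/-- The defining property of `pullbackHom`: `ψ ∘ pullbackHom ψ v = v ∘ ψ`.
[cite: MochizukiFrdI2008, Prop. 2.2(ii) p.45] -/
theorem intertwines_pullbackHom (hiso : IsOfIsotropicType F) (ψ : A ⟶ A')
    (hψ : IsPullbackMorphism F ψ) (v : BiratUnits F hF A') :
    Intertwines hF ψ (pullbackHom hF hsq hiso ψ hψ v) v :=
  (exists_intertwines_of_isPullbackMorphism hF hiso ψ hψ v).choose_spec

/-- Characterisation: `u = pullbackHom ψ v ↔ ψ ∘ u = v ∘ ψ`.
[cite: MochizukiFrdI2008, Prop. 2.2(ii) p.45] -/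
theorem intertwines_iff_eq_pullbackHom (hiso : IsOfIsotropicType F) (ψ : A ⟶ A')
    (hψ : IsPullbackMorphism F ψ) (u : BiratUnits F hF A) (v : BiratUnits F hF A') :
    Intertwines hF ψ u v ↔ u = pullbackHom hF hsq hiso ψ hψ v :=
  ⟨fun h => eq_of_intertwines_of_isPullbackMorphism hsq hψ h (intertwines_pullbackHom hiso ψ hψ v),
    fun h => h ▸ intertwines_pullbackHom hiso ψ hψ v⟩

end BiratUnits

end PreFrobenioid

end Literature.AlgebraicGeometry.Frobenioids
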